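import Summits.HodgeConjecture.HodgeConjecture.Theorems.H413CohFormsCarriers
import HarnessLib

/-!
# FLOOR-0 P4/P2 carriers — first lemmas: `U(V)(𝔸_{F⁺,f})`-stability of the cotangent forms, complex conjugation, and
# «the components `u ↦ f (ιinf u · (1,g))` determine the form»

Cell hodgecm-mathlib (D-0151), FLOOR 0, crux item H413 = stmt-HodgeConjecture-24833; programme P4 «admissible occurs in H¹» (line
`Cruxes/H413/Lines/P4AdmissibleOccursInH1.lean` v2.1, stubs `stub_T2_matsushimaHodgeAt` / `stub_T3_thetaFormsAt` at the factor of record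
`archFactorOf F V`).  Author A-p13 (g21).  PROOF lane (theorems only), `--supports stmt-HodgeConjecture-24833`.

For an archimedean factor `𝔞` satisfying the carriers' `ArchFactor.IsHonest` (in particular `𝔞 = archFactorOf F V`,
`P4StubT1ArchFactor.archFactorOf_isHonest`):
* §1 `IsHonest.rightRep_mem_holCotForms` / `_cohForms` — the finite-adelic right translation `R_g` preserves `holCotForms 𝔞` and `cohForms 𝔞`
  (left invariance is untouched; the `K_∞`-type, the `K_c`-invariance and the holomorphic germs ride along because `(1,g)` commutes with
  `ιinf (U(2,1))` and with `K_c` — clauses (4), (5) of `IsHonest`; smoothness because `R_g` maps `K_f`-invariants to `g K_f g⁻¹`-invariants).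
  This is the `G_f`-module structure the stubs T2′/T3′ (and P2's U1′/U2′) speak about. [cite: BorelJacquet1979, §4.2]
* §2 `conjFun_conjFun`, `conjFun_rightRep`, `conjFun_mem_cohForms` — `cohForms 𝔞 = holCotForms 𝔞 ⊔ conj (holCotForms 𝔞)` is stable under
  the conjugate-linear involution `conjFun` and `conjFun` commutes with `R_g`. [cite: BorelWallach2000, VII 2.10]
* §3 `IsHonest.eq_zero_of_forall_comp_eq_zero` — a right-`K_c`-invariant function all of whose COMPONENTS `u ↦ f (ιinf u · (1,g))` vanish is
  zero (product decomposition `x = ιinf u · k · (1,g)`, clause (6)); hence `IsHonest.eq_zero_of_mem_holCotForms` / `_cohForms` — the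
  injectivity half of T2′'s class map reduces to the injectivity of the level class maps. [cite: BorelJacquet1979, §4.1]

HC_CM is proved only modulo the 7 printed citations until rung 0 closes; this file proves nothing about them.

## References
* [BorelJacquet1979] A. Borel, H. Jacquet, Corvallis PSPM 33.1, §4.1–§4.2.
* [BorelWallach2000] A. Borel, N. Wallach, 2nd ed., VII 2.10.
* Tree: `Theorems/H413CohFormsCarriers` (carriers, namespace `…Cruxes.H413.CohFormsCarriers`); HodgeCM `Model/ThetaHolGerm`
  (`IsHolGerm.comp_mul_right`); ★ `Automorphic/WeightForms`.
-/

set_option autoImplicit false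
set_option linter.dupNamespace false

noncomputable section

namespace Summit.HodgeConjecture.HodgeConjecture.Cruxes.H413.CohFormsCarriers

open NumberField MulAction
open Literature.NumberTheory.Automorphic
open Literature.AlgebraicGeometry.ShimuraVarieties
open Literature.Geometry.ComplexHyperbolic.BallModel (U21 x₀)

variable {F : HodgeCM.CMField} {ι₁ : F →+* ℂ} {V : HodgeCM.HermSpace3 F ι₁}

/-! ## §1 Stability under the finite-adelic right translation -/

/-- `R_g` preserves the `K_f`-smooth vectors: a `K_f`-invariant function goes to a `g K_f g⁻¹`-invariant one. [cite: BorelJacquet1979, §4.2] -/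
theorem rightRep_mem_smoothFun {f : (adelicDatum F V).Adelic → (Fin 2 → ℂ)} (hf : f ∈ smoothFun F V)
    (g : ↥(HodgeCM.HermSpace3.adelicFin V)) : rightRep F V g f ∈ smoothFun F V := by
  -- `smoothFun` is the span of the `K_f`-invariants; it suffices to treat one open `K_f`
  refine Submodule.iSup_induction _ (motive := fun f => rightRep F V g f ∈ smoothFun F V) hf ?_ ?_ ?_
  · intro Kf f' hf'
    refine Submodule.iSup_induction _ (motive := fun f => rightRep F V g f ∈ smoothFun F V) hf' ?_ ?_ ?_
    · intro hKf f'' hf''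
      -- `R_g f''` is invariant under the open subgroup `g K_f g⁻¹`
      let Kg : Subgroup ↥(HodgeCM.HermSpace3.adelicFin V) := Kf.map (MulAut.conj g).toMonoidHom
      have hKg : IsOpen (Kg : Set ↥(HodgeCM.HermSpace3.adelicFin V)) := by
        have e : (Kg : Set ↥(HodgeCM.HermSpace3.adelicFin V)) = (Homeomorph.mulLeft g).trans (Homeomorph.mulRight g⁻¹) '' (Kf : Set _) := by
          ext k
          simp only [Kg, Subgroup.coe_map, MulEquiv.coe_toMonoidHom, MulAut.conj_apply, Set.mem_image, SetLike.mem_coe,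
            Homeomorph.trans_apply, Homeomorph.coe_mulLeft, Homeomorph.coe_mulRight]
        rw [e]
        exact ((Homeomorph.mulLeft g).trans (Homeomorph.mulRight g⁻¹)).isOpenMap _ hKf
      refine Submodule.mem_iSup_of_mem Kg (Submodule.mem_iSup_of_mem hKg ?_)
      rw [Representation.mem_invariants]
      intro k
      obtain ⟨k₀, hk₀, hk⟩ := Subgroup.mem_map.1 k.2
      have hfix : (rightRep F V).comp Kf.subtype ⟨k₀, hk₀⟩ f'' = f'' := (Representation.mem_invariants _ _).1 hf'' ⟨k₀, hk₀⟩
      funext x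
      have hk' : (k : ↥(HodgeCM.HermSpace3.adelicFin V)) = g * k₀ * g⁻¹ := by
        rw [← hk]; rfl
      have h1 := congrFun hfix (x * finToAdelic F V g)
      simp only [MonoidHom.coe_comp, Subgroup.coe_subtype, Function.comp_apply] at h1
      show f'' (x * finToAdelic F V (k : ↥(HodgeCM.HermSpace3.adelicFin V)) * finToAdelic F V g) = f'' (x * finToAdelic F V g)
      rw [hk', map_mul, map_mul, map_inv]
      have h2 : x * (finToAdelic F V g * finToAdelic F V k₀ * (finToAdelic F V g)⁻¹) * finToAdelic F V g =
          x * finToAdelic F V g * finToAdelic F V k₀ := by group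
      rw [h2]
      exact h1
    · simp
    · intro a b ha hb
      simpa using Submodule.add_mem _ ha hb
  · simp
  · intro a b ha hb
    simpa using Submodule.add_mem _ ha hb

/-- **`R_g` preserves `holCotForms 𝔞`** for an honest archimedean factor. [cite: BorelJacquet1979, §4.2] -/
theorem ArchFactor.IsHonest.rightRep_mem_holCotForms {𝔞 : ArchFactor F V} (h𝔞 : 𝔞.IsHonest)
    {f : (adelicDatum F V).Adelic → (Fin 2 → ℂ)} (hf : f ∈ holCotForms 𝔞) (g : ↥(HodgeCM.HermSpace3.adelicFin V)) :
    rightRep F V g f ∈ holCotForms 𝔞 := by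
  obtain ⟨⟨⟨hW, hK⟩, hS⟩, hH⟩ := hf
  obtain ⟨_, _, _, hcommF, hcommKF, _, _⟩ := h𝔞
  refine ⟨⟨⟨⟨fun γ hγ x => ?_, fun k x => ?_⟩, fun k hk x => ?_⟩, rightRep_mem_smoothFun hS g⟩, ?_⟩
  · -- left invariance
    show f (γ * x * finToAdelic F V g) = f (x * finToAdelic F V g)
    rw [mul_assoc]; exact hW.1 γ hγ _
  · -- `K_∞`-type along `ιinf ∘ κ`
    show f (x * (𝔞.ιinf.comp (stabilizer (↥U21) x₀).subtype) k * finToAdelic F V g) =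
      (BallForms.isPullbackCocycle_cotangentCocycle.weightOf x₀) k⁻¹ (f (x * finToAdelic F V g))
    rw [MonoidHom.comp_apply, mul_assoc, hcommF, ← mul_assoc]
    exact hW.2 k _
  · -- `K_c`-invariance
    show f (x * k * finToAdelic F V g) = f (x * finToAdelic F V g)
    rw [mul_assoc, hcommKF k hk g, ← mul_assoc]; exact hK k hk _
  · -- holomorphic germs
    exact HodgeCM.Model.IsHolGerm.comp_mul_right hH fun u => (hcommF u g).symm

/-! ## §2 Complex conjugation -/

variable (F V) in
/-- `conjFun` is an involution. [cite: BorelWallach2000, VII 2.10] -/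
@[simp] theorem conjFun_conjFun (f : (adelicDatum F V).Adelic → (Fin 2 → ℂ)) : conjFun F V (conjFun F V f) = f := by
  funext x; ext j; simp [conjFun]

variable (F V) in
/-- `conjFun` commutes with the finite-adelic right translation. [cite: BorelWallach2000, VII 2.10] -/
theorem conjFun_rightRep (g : ↥(HodgeCM.HermSpace3.adelicFin V)) (f : (adelicDatum F V).Adelic → (Fin 2 → ℂ)) :
    conjFun F V (rightRep F V g f) = rightRep F V g (conjFun F V f) := rfl

/-- `holCotForms 𝔞 ≤ cohForms 𝔞`. [cite: BorelWallach2000, VII 2.10] -/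
theorem holCotForms_le_cohForms (𝔞 : ArchFactor F V) : holCotForms 𝔞 ≤ cohForms 𝔞 := le_sup_left

/-- The conjugate of a holomorphic cotangent form is a cohomological cotangent form. [cite: BorelWallach2000, VII 2.10] -/
theorem conjFun_mem_cohForms_of_mem_holCotForms {𝔞 : ArchFactor F V} {f : (adelicDatum F V).Adelic → (Fin 2 → ℂ)}
    (hf : f ∈ holCotForms 𝔞) : conjFun F V f ∈ cohForms 𝔞 :=
  Submodule.mem_sup_right (Submodule.mem_map_of_mem hf)

/-- **`cohForms 𝔞` is stable under `conjFun`.** [cite: BorelWallach2000, VII 2.10] -/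
theorem conjFun_mem_cohForms {𝔞 : ArchFactor F V} {f : (adelicDatum F V).Adelic → (Fin 2 → ℂ)} (hf : f ∈ cohForms 𝔞) :
    conjFun F V f ∈ cohForms 𝔞 := by
  obtain ⟨a, ha, b, hb, rfl⟩ := Submodule.mem_sup.1 hf
  obtain ⟨b₀, hb₀, rfl⟩ := Submodule.mem_map.1 hb
  rw [map_add, conjFun_conjFun]
  exact Submodule.add_mem _ (conjFun_mem_cohForms_of_mem_holCotForms ha) (holCotForms_le_cohForms 𝔞 hb₀)

/-- **`R_g` preserves `cohForms 𝔞`** for an honest archimedean factor. [cite: BorelJacquet1979, §4.2] -/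
theorem ArchFactor.IsHonest.rightRep_mem_cohForms {𝔞 : ArchFactor F V} (h𝔞 : 𝔞.IsHonest)
    {f : (adelicDatum F V).Adelic → (Fin 2 → ℂ)} (hf : f ∈ cohForms 𝔞) (g : ↥(HodgeCM.HermSpace3.adelicFin V)) :
    rightRep F V g f ∈ cohForms 𝔞 := by
  obtain ⟨a, ha, b, hb, rfl⟩ := Submodule.mem_sup.1 hf
  obtain ⟨b₀, hb₀, rfl⟩ := Submodule.mem_map.1 hb
  rw [map_add, ← conjFun_rightRep]
  exact Submodule.add_mem _ (holCotForms_le_cohForms 𝔞 (h𝔞.rightRep_mem_holCotForms ha g))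
    (conjFun_mem_cohForms_of_mem_holCotForms (h𝔞.rightRep_mem_holCotForms hb₀ g))

/-! ## §3 The components determine the form -/

/-- **A right-`K_c`-invariant function whose components `u ↦ f (ιinf u · (1,g))` all vanish is zero** (product decomposition of
`U(V)(𝔸_{F⁺})`, clause (6) of `IsHonest`, and the commutation of `K_c` with the finite-adelic factor, clause (5)). [cite: BorelJacquet1979, §4.1] -/
theorem ArchFactor.IsHonest.eq_zero_of_forall_comp_eq_zero {𝔞 : ArchFactor F V} (h𝔞 : 𝔞.IsHonest)
    {f : (adelicDatum F V).Adelic → (Fin 2 → ℂ)} (hK : ∀ k ∈ 𝔞.Kc, ∀ x, f (x * k) = f x)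
    (h0 : ∀ (u : ↥U21) (g : ↥(HodgeCM.HermSpace3.adelicFin V)), f (𝔞.ιinf u * finToAdelic F V g) = 0) : f = 0 := by
  obtain ⟨_, _, _, _, hcommKF, hdec, _⟩ := h𝔞
  funext x
  obtain ⟨u, k, g, hk, rfl⟩ := hdec x
  rw [mul_assoc, hcommKF k hk g, ← mul_assoc, hK k hk]
  exact h0 u g

/-- The `K_c`-invariance clause of `holCotForms`. [cite: BorelJacquet1979, §4.1] -/
theorem apply_mul_eq_of_mem_holCotForms {𝔞 : ArchFactor F V} {f : (adelicDatum F V).Adelic → (Fin 2 → ℂ)}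
    (hf : f ∈ holCotForms 𝔞) {k : (adelicDatum F V).Adelic} (hk : k ∈ 𝔞.Kc) (x : (adelicDatum F V).Adelic) :
    f (x * k) = f x :=
  hf.1.1.2 k hk x

/-- The `K_c`-invariance of cohomological cotangent forms. [cite: BorelJacquet1979, §4.1] -/
theorem apply_mul_eq_of_mem_cohForms {𝔞 : ArchFactor F V} {f : (adelicDatum F V).Adelic → (Fin 2 → ℂ)}
    (hf : f ∈ cohForms 𝔞) {k : (adelicDatum F V).Adelic} (hk : k ∈ 𝔞.Kc) (x : (adelicDatum F V).Adelic) :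
    f (x * k) = f x := by
  obtain ⟨a, ha, b, hb, rfl⟩ := Submodule.mem_sup.1 hf
  obtain ⟨b₀, hb₀, rfl⟩ := Submodule.mem_map.1 hb
  simp only [Pi.add_apply]
  rw [apply_mul_eq_of_mem_holCotForms ha hk]
  congr 1
  show star (b₀ (x * k)) = star (b₀ x)
  rw [apply_mul_eq_of_mem_holCotForms hb₀ hk]

/-- **A cohomological cotangent form with vanishing components is zero** — the reduction of the injectivity of T2′'s class map
to the injectivity of the level class maps. [cite: BorelJacquet1979, §4.1] -/
theorem ArchFactor.IsHonest.eq_zero_of_mem_cohForms {𝔞 : ArchFactor F V} (h𝔞 : 𝔞.IsHonest)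
    {f : (adelicDatum F V).Adelic → (Fin 2 → ℂ)} (hf : f ∈ cohForms 𝔞)
    (h0 : ∀ (u : ↥U21) (g : ↥(HodgeCM.HermSpace3.adelicFin V)), f (𝔞.ιinf u * finToAdelic F V g) = 0) : f = 0 :=
  h𝔞.eq_zero_of_forall_comp_eq_zero (fun _ hk x => apply_mul_eq_of_mem_cohForms hf hk x) h0

end Summit.HodgeConjecture.HodgeConjecture.Cruxes.H413.CohFormsCarriers

end
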